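import Summits.Ventures.PercRepro.RankLevelSetRuleQCell

/-!
# PercRepro — RULE Q AT THE TIGHT LAYER: THE CELL INEQUALITIES `RhatCell q k` BY KERNEL EVALUATION (RankLevelSetRuleQCellEvalW28Q3; night-1, gen 14)

Each theorem `rhatCell_q_k : RhatCell q k` (`∀ m ≤ q, Φ(q+k, q) ≤ R̂(q, k, m)`, RankLevelSetRuleQCell) is discharged by
`interval_cases m` and `norm_num` on the unfolded binomial sums (`Nat.choose` by its recursion; the
`Finset.Ioo`-sums as `Finset.range`-sums via `sum_Ioo_nat`). No `native_decide`, no `decide` on the rationals. With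
`hallUp_of_ncard_eq_of_rhatCell` each cell gives the UP form of C-044 at the tight layer `#E = (q+k) + q` of the cell
`(q+k, q)` for every finite matroid; the DOWN form is `hallDown_of_ncard_eq`. Cells: (3,19), (3,20), (3,21), (3,22).
Axioms: standard.
-/

namespace PercRepro

open Finset

/-- `Φ(22, 3) ≤ R̂(3, 19, 0)` (the cell `(22, 3)` at `#P = 0`), by kernel evaluation. -/
theorem rhatCell_3_19_0 : phiK (3 + 19) 3 ≤ rhat 3 19 0 := by
  simp only [rhat, phiK, mhat, sum_Ioo_nat]
  norm_num [Finset.sum_range_succ, Nat.choose, Nat.min_def]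

/-- `Φ(22, 3) ≤ R̂(3, 19, 1)` (the cell `(22, 3)` at `#P = 1`), by kernel evaluation. -/
theorem rhatCell_3_19_1 : phiK (3 + 19) 3 ≤ rhat 3 19 1 := by
  simp only [rhat, phiK, mhat, sum_Ioo_nat]
  norm_num [Finset.sum_range_succ, Nat.choose, Nat.min_def]

/-- `Φ(22, 3) ≤ R̂(3, 19, 2)` (the cell `(22, 3)` at `#P = 2`), by kernel evaluation. -/
theorem rhatCell_3_19_2 : phiK (3 + 19) 3 ≤ rhat 3 19 2 := by
  simp only [rhat, phiK, mhat, sum_Ioo_nat]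
  norm_num [Finset.sum_range_succ, Nat.choose, Nat.min_def]

/-- `Φ(22, 3) ≤ R̂(3, 19, 3)` (the cell `(22, 3)` at `#P = 3`), by kernel evaluation. -/
theorem rhatCell_3_19_3 : phiK (3 + 19) 3 ≤ rhat 3 19 3 := by
  simp only [rhat, phiK, mhat, sum_Ioo_nat]
  norm_num [Finset.sum_range_succ, Nat.choose, Nat.min_def]

/-- The cell `(22, 3)` (`q = 3`, `k = 19`): `Φ(22, 3) ≤ R̂(3, 19, m)` for every `m ≤ 3`. -/
theorem rhatCell_3_19 : RhatCell 3 19 := by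
  intro m hm
  interval_cases m
  · exact rhatCell_3_19_0
  · exact rhatCell_3_19_1
  · exact rhatCell_3_19_2
  · exact rhatCell_3_19_3

/-- `Φ(23, 3) ≤ R̂(3, 20, 0)` (the cell `(23, 3)` at `#P = 0`), by kernel evaluation. -/
theorem rhatCell_3_20_0 : phiK (3 + 20) 3 ≤ rhat 3 20 0 := by
  simp only [rhat, phiK, mhat, sum_Ioo_nat]
  norm_num [Finset.sum_range_succ, Nat.choose, Nat.min_def]

/-- `Φ(23, 3) ≤ R̂(3, 20, 1)` (the cell `(23, 3)` at `#P = 1`), by kernel evaluation. -/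
theorem rhatCell_3_20_1 : phiK (3 + 20) 3 ≤ rhat 3 20 1 := by
  simp only [rhat, phiK, mhat, sum_Ioo_nat]
  norm_num [Finset.sum_range_succ, Nat.choose, Nat.min_def]

/-- `Φ(23, 3) ≤ R̂(3, 20, 2)` (the cell `(23, 3)` at `#P = 2`), by kernel evaluation. -/
theorem rhatCell_3_20_2 : phiK (3 + 20) 3 ≤ rhat 3 20 2 := by
  simp only [rhat, phiK, mhat, sum_Ioo_nat]
  norm_num [Finset.sum_range_succ, Nat.choose, Nat.min_def]

/-- `Φ(23, 3) ≤ R̂(3, 20, 3)` (the cell `(23, 3)` at `#P = 3`), by kernel evaluation. -/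
theorem rhatCell_3_20_3 : phiK (3 + 20) 3 ≤ rhat 3 20 3 := by
  simp only [rhat, phiK, mhat, sum_Ioo_nat]
  norm_num [Finset.sum_range_succ, Nat.choose, Nat.min_def]

/-- The cell `(23, 3)` (`q = 3`, `k = 20`): `Φ(23, 3) ≤ R̂(3, 20, m)` for every `m ≤ 3`. -/
theorem rhatCell_3_20 : RhatCell 3 20 := by
  intro m hm
  interval_cases m
  · exact rhatCell_3_20_0
  · exact rhatCell_3_20_1
  · exact rhatCell_3_20_2
  · exact rhatCell_3_20_3

/-- `Φ(24, 3) ≤ R̂(3, 21, 0)` (the cell `(24, 3)` at `#P = 0`), by kernel evaluation. -/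
theorem rhatCell_3_21_0 : phiK (3 + 21) 3 ≤ rhat 3 21 0 := by
  simp only [rhat, phiK, mhat, sum_Ioo_nat]
  norm_num [Finset.sum_range_succ, Nat.choose, Nat.min_def]

/-- `Φ(24, 3) ≤ R̂(3, 21, 1)` (the cell `(24, 3)` at `#P = 1`), by kernel evaluation. -/
theorem rhatCell_3_21_1 : phiK (3 + 21) 3 ≤ rhat 3 21 1 := by
  simp only [rhat, phiK, mhat, sum_Ioo_nat]
  norm_num [Finset.sum_range_succ, Nat.choose, Nat.min_def]

/-- `Φ(24, 3) ≤ R̂(3, 21, 2)` (the cell `(24, 3)` at `#P = 2`), by kernel evaluation. -/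
theorem rhatCell_3_21_2 : phiK (3 + 21) 3 ≤ rhat 3 21 2 := by
  simp only [rhat, phiK, mhat, sum_Ioo_nat]
  norm_num [Finset.sum_range_succ, Nat.choose, Nat.min_def]

/-- `Φ(24, 3) ≤ R̂(3, 21, 3)` (the cell `(24, 3)` at `#P = 3`), by kernel evaluation. -/
theorem rhatCell_3_21_3 : phiK (3 + 21) 3 ≤ rhat 3 21 3 := by
  simp only [rhat, phiK, mhat, sum_Ioo_nat]
  norm_num [Finset.sum_range_succ, Nat.choose, Nat.min_def]

/-- The cell `(24, 3)` (`q = 3`, `k = 21`): `Φ(24, 3) ≤ R̂(3, 21, m)` for every `m ≤ 3`. -/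
theorem rhatCell_3_21 : RhatCell 3 21 := by
  intro m hm
  interval_cases m
  · exact rhatCell_3_21_0
  · exact rhatCell_3_21_1
  · exact rhatCell_3_21_2
  · exact rhatCell_3_21_3

/-- `Φ(25, 3) ≤ R̂(3, 22, 0)` (the cell `(25, 3)` at `#P = 0`), by kernel evaluation. -/
theorem rhatCell_3_22_0 : phiK (3 + 22) 3 ≤ rhat 3 22 0 := by
  simp only [rhat, phiK, mhat, sum_Ioo_nat]
  norm_num [Finset.sum_range_succ, Nat.choose, Nat.min_def]

/-- `Φ(25, 3) ≤ R̂(3, 22, 1)` (the cell `(25, 3)` at `#P = 1`), by kernel evaluation. -/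
theorem rhatCell_3_22_1 : phiK (3 + 22) 3 ≤ rhat 3 22 1 := by
  simp only [rhat, phiK, mhat, sum_Ioo_nat]
  norm_num [Finset.sum_range_succ, Nat.choose, Nat.min_def]

/-- `Φ(25, 3) ≤ R̂(3, 22, 2)` (the cell `(25, 3)` at `#P = 2`), by kernel evaluation. -/
theorem rhatCell_3_22_2 : phiK (3 + 22) 3 ≤ rhat 3 22 2 := by
  simp only [rhat, phiK, mhat, sum_Ioo_nat]
  norm_num [Finset.sum_range_succ, Nat.choose, Nat.min_def]

/-- `Φ(25, 3) ≤ R̂(3, 22, 3)` (the cell `(25, 3)` at `#P = 3`), by kernel evaluation. -/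
theorem rhatCell_3_22_3 : phiK (3 + 22) 3 ≤ rhat 3 22 3 := by
  simp only [rhat, phiK, mhat, sum_Ioo_nat]
  norm_num [Finset.sum_range_succ, Nat.choose, Nat.min_def]

/-- The cell `(25, 3)` (`q = 3`, `k = 22`): `Φ(25, 3) ≤ R̂(3, 22, m)` for every `m ≤ 3`. -/
theorem rhatCell_3_22 : RhatCell 3 22 := by
  intro m hm
  interval_cases m
  · exact rhatCell_3_22_0
  · exact rhatCell_3_22_1
  · exact rhatCell_3_22_2
  · exact rhatCell_3_22_3

end PercRepro
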